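import Summits.PneNP.PneNP.Theses.LatticeMagic

/-!
# Sketch — crux-ideate stmt-PneNP-10709 (`LatticeMagic.Target`), ideator 1, round 1

Typed first lemmas for the two idea cards

* A `encoder-lattice-csp-import` : the encoder lattice `L_{G}` of a XOR system `G y = b` and the
  identity `dist((𝟙, 2b), L_G)² = n + 4 · minUnsat`; the average-case apex `XorIrrefutable` and
  the bridge `target_of_xorIrrefutable`.
* B `hecke-randomization` : the Goldstein–Mayer family `Λ_p(a)`, the average-case apex
  `GMIrrefutable`, the density bridge `target_of_gmIrrefutable`, the superlattice move and its
  far-preservation count `superlattice_far`, and the random-self-reduction claim `HeckeRSR`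
  (the line's main stub: `TargetAt (2c) → GMIrrefutable c`).

Everything elaborates; proofs are deferred (`sorry`) except where trivial.
-/

noncomputable section

open scoped BigOperators Classical
open scoped Pointwise
open Metric Literature.Algebra.EuclideanLattices Literature.Computability.Complexity

namespace Summit.PneNP.PneNP.Cruxes.Target.Ideator1

/-! ## The crux at a given factor -/

/-- `GapCVP_c ∉ PromiseCoNP` at the constant factor `c` (the route's `Target` is `∃ c ≥ 1, TargetAt c`). -/
def TargetAt (c : ℝ) : Prop :=
  PromiseProblem.ofEncoding gapCVPInstanceEncoding (GapCVP.yes (fun _ => c)) (GapCVP.no (fun _ => c)) ∉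
    PromiseCoNP

theorem target_iff : Summit.PneNP.PneNP.Theses.LatticeMagic.Target ↔ ∃ c : ℝ, 1 ≤ c ∧ TargetAt c :=
  Iff.rfl

/-! ## Card A — the encoder lattice of a XOR system -/

section Encoder

variable {m n : ℕ}

/-- Number of equations of `G y = b (mod 2)` violated by the Boolean assignment `y`. -/
def unsatCount (G : Matrix (Fin m) (Fin n) Bool) (b : Fin m → Bool) (y : Fin n → Bool) : ℕ :=
  (Finset.univ.filter fun j : Fin m =>
    (∑ i : Fin n, (if G j i && y i then (1 : ZMod 2) else 0)) ≠ (if b j then 1 else 0)).card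

/-- `minUnsat G b = min_y #{j : (G y)_j ≠ b_j}` = Hamming distance from `b` to the code `{G y}`. -/
def minUnsat (G : Matrix (Fin m) (Fin n) Bool) (b : Fin m → Bool) : ℕ :=
  Finset.univ.inf' Finset.univ_nonempty (unsatCount G b)

/-- The ENCODER LATTICE basis (row convention of `LatticeInstance`): rows `(2eᵢ, 2G·ᵢ)` for the
`n` variables and `(0, 4eⱼ)` for the `m` equations, i.e. the block matrix `[[2·1, 2Gᵀ],[0, 4·1]]`;
its lattice is `{(2y, 2Gy + 4w) : y ∈ ℤⁿ, w ∈ ℤᵐ}` = twice Construction A of the SYSTEMATIC code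
`{(u, Gu)}` — no Gaussian elimination is performed to write it down. -/
def encBasis (G : Matrix (Fin m) (Fin n) Bool) : Matrix (Fin (n + m)) (Fin (n + m)) ℤ :=
  Matrix.reindex finSumFinEquiv finSumFinEquiv
    (Matrix.fromBlocks ((2 : ℤ) • (1 : Matrix (Fin n) (Fin n) ℤ))
      (Matrix.of fun i j => if G j i then 2 else 0) 0 ((4 : ℤ) • (1 : Matrix (Fin m) (Fin m) ℤ)))

/-- The target `(𝟙ₙ, 2b)`: half-way between `0` and `2` on every variable coordinate (so that the
variable block contributes exactly `n` for every Boolean `y`), and `2b` on the equation block. -/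
def encTarget (b : Fin m → Bool) : Fin (n + m) → ℤ :=
  fun r => Sum.elim (fun _ : Fin n => (1 : ℤ)) (fun j : Fin m => if b j then 2 else 0) (finSumFinEquiv.symm r)

/-- The `GapCVP` instance of the XOR system `(G, b)` at YES-threshold `K` unsatisfied equations:
threshold `d = ⌊√(n + 4K)⌋ + 1`, so `minUnsat ≤ K ⇒ dist < d`. -/
def encInst (G : Matrix (Fin m) (Fin n) Bool) (b : Fin m → Bool) (K : ℕ) : GapCVPInstance :=
  (⟨⟨n + m, encBasis G⟩, encTarget b⟩, ((Nat.sqrt (n + 4 * K) + 1 : ℕ) : ℚ))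

/-- THE IDENTITY (first checkable statement of card A): the squared distance from `(𝟙, 2b)` to the
encoder lattice is `n + 4 · minUnsat(G, b)` — the variable block costs `(2yᵢ - 1)² ≥ 1` with
equality iff `yᵢ ∈ {0,1}`, the equation block costs `4·((Gy)ⱼ + 2wⱼ - bⱼ)²`, minimised over `wⱼ`
to `4·[(Gy)ⱼ ≢ bⱼ mod 2]`. -/
theorem encoder_infDist_sq (G : Matrix (Fin m) (Fin n) Bool) (b : Fin m → Bool) (K : ℕ) :
    (infDist (encInst G b K).1.targetE (encInst G b K).1.I.lattice) ^ 2 = n + 4 * (minUnsat G b : ℝ) := by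
  sorry

theorem encInst_isNonsingular (G : Matrix (Fin m) (Fin n) Bool) (b : Fin m → Bool) (K : ℕ) :
    (encInst G b K).1.I.IsNonsingular := by
  show (encBasis G).det ≠ 0
  rw [encBasis, Matrix.det_reindex_self, Matrix.det_fromBlocks_zero₂₁, Matrix.det_smul,
    Matrix.det_smul, Matrix.det_one, Matrix.det_one]
  simp

/-- YES side: at most `K` violated equations puts the instance in `GapCVP.yes`. -/
theorem encInst_mem_yes (γ : ℕ → ℝ) (G : Matrix (Fin m) (Fin n) Bool) (b : Fin m → Bool) (K : ℕ)
    (h : minUnsat G b ≤ K) : encInst G b K ∈ GapCVP.yes γ := by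
  sorry

/-- NO side: `c² d² < n + 4 minUnsat` puts the instance in `GapCVP.no c`. -/
theorem encInst_mem_no (c : ℝ) (G : Matrix (Fin m) (Fin n) Bool) (b : Fin m → Bool) (K : ℕ)
    (h : c ^ 2 * ((Nat.sqrt (n + 4 * K) + 1 : ℕ) : ℝ) ^ 2 < n + 4 * (minUnsat G b : ℝ)) :
    encInst G b K ∈ GapCVP.no (fun _ => c) := by
  sorry

end Encoder

/-- The random family: `Δn` equations on `n` variables, uniform `(G, b)`, YES-threshold `K = n`. -/
abbrev XorFamily (Δ n : ℕ) : Type := Matrix (Fin (Δ * n)) (Fin n) Bool × (Fin (Δ * n) → Bool)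

/-- APEX of card A (average-case, one-sided): no NP language avoids the codes of the
`n`-satisfiable members of the family (`minUnsat ≤ n`, YES instances at threshold `d`) while
containing the codes of at least half of all members, for all large `n`.  Equivalently: "typical
XOR systems at density `Δ` have no polynomial-size refutation of `n`-satisfiability in ANY sound
proof system" — the XOR sibling of `Feige.NoShortRefutations`, read through the encoder lattice. -/
def XorIrrefutable (Δ : ℕ) : Prop :=
  ¬ ∃ L ∈ Nondeterministic.NP,
      (∀ (n : ℕ) (Gb : XorFamily Δ n), minUnsat Gb.1 Gb.2 ≤ n → GapCVPInstance.encode (encInst Gb.1 Gb.2 n) ∉ L) ∧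
      ∃ n₀ : ℕ, ∀ n ≥ n₀, Fintype.card (XorFamily Δ n) ≤
        2 * (Finset.univ.filter fun Gb : XorFamily Δ n => GapCVPInstance.encode (encInst Gb.1 Gb.2 n) ∈ L).card

/-- Density (provable: for EVERY `G`, `b ↦ minUnsat` is a minimum of `2ⁿ` binomial Hamming
distances; Chernoff + union bound give `minUnsat ≥ (1/2 - ε)Δn` for all but a `2ⁿe^{-2ε²Δn}`
fraction of `b`): at least half of the family is far at factor `c`, for all large `n`. -/
def XorMostlyFar (c : ℝ) (Δ : ℕ) : Prop :=
  ∃ n₀ : ℕ, ∀ n ≥ n₀, Fintype.card (XorFamily Δ n) ≤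
    2 * (Finset.univ.filter fun Gb : XorFamily Δ n =>
      c ^ 2 * ((Nat.sqrt (n + 4 * n) + 1 : ℕ) : ℝ) ^ 2 < n + 4 * (minUnsat Gb.1 Gb.2 : ℝ)).card

/-- FIRST LEMMA of card A (bridge, provable now from the four `encInst_*` lemmas and
`Computability.Encoding` injectivity): if typical XOR systems of density `Δ` are `c`-far and
irrefutable on average, then `GapCVP_c ∉ PromiseCoNP`. -/
theorem targetAt_of_xorIrrefutable (c : ℝ) (Δ : ℕ) (hfar : XorMostlyFar c Δ)
    (hirr : XorIrrefutable Δ) : TargetAt c := by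
  intro hmem
  apply hirr
  obtain ⟨L, hL, hyes, hno⟩ := hmem
  have hL' : Lᶜ ∈ Nondeterministic.NP := hL
  refine ⟨Lᶜ, hL', ?_, ?_⟩
  · intro n Gb hK hcode
    exact hcode (hyes ((Computability.Encoding.mem_toLanguage_iff _ _ _).2
      (encInst_mem_yes (fun _ => c) Gb.1 Gb.2 n hK)))
  · obtain ⟨n₀, hn₀⟩ := hfar
    refine ⟨n₀, fun n hn => (hn₀ n hn).trans (Nat.mul_le_mul_left 2 (Finset.card_le_card ?_))⟩
    intro Gb hGb
    simp only [Finset.mem_filter, Finset.mem_univ, true_and] at hGb ⊢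
    exact hno ((Computability.Encoding.mem_toLanguage_iff _ _ _).2 (encInst_mem_no c Gb.1 Gb.2 n hGb))

theorem target_of_xorIrrefutable (c : ℝ) (hc : 1 ≤ c) (Δ : ℕ) (hfar : XorMostlyFar c Δ)
    (hirr : XorIrrefutable Δ) : Summit.PneNP.PneNP.Theses.LatticeMagic.Target :=
  ⟨c, hc, targetAt_of_xorIrrefutable c Δ hfar hirr⟩

/-- Arithmetic of the density condition (ε = 0.05): `5.3 c² < 1 + 1.8 Δ` suffices eventually (recorded, not used). -/
def XorDensityCondition (c : ℝ) (Δ : ℕ) : Prop := 53 * c ^ 2 < 10 + 18 * (Δ : ℝ)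

/-! ## Card B — Hecke randomization: the Goldstein–Mayer family and the superlattice move -/

section GM

variable {n : ℕ}

/-- Basis of the Goldstein–Mayer lattice `Λ_p(a) = {x ∈ ℤⁿ⁺¹ : x_n ≡ Σ aᵢ xᵢ (mod p)}` (index `p` in
`ℤⁿ⁺¹`): rows `eᵢ + aᵢ e_n` (`i < n`) and `p·e_n`.  As `p → ∞` these equidistribute to Haar measure
on the space of lattices (Goldstein–Mayer 2003); it is also the `q`-ary lattice `Λ_p([1 | a])` of
lattice cryptography with one parity check. -/
def gmBasis (p : ℕ) (a : Fin n → Fin p) : Matrix (Fin (n + 1)) (Fin (n + 1)) ℤ :=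
  Matrix.of fun r c =>
    if h : (r : ℕ) < n then
      (if c = r then 1 else if c = Fin.last n then ((a ⟨r, h⟩ : ℕ) : ℤ) else 0)
    else (if c = Fin.last n then (p : ℤ) else 0)

/-- The HALF-POINT instance `(2Λ_p(a), x_ε, d)`: lattice `2Λ_p(a)` (basis `2·gmBasis`), integer target
`x_ε = Σ εᵢ rᵢ ∈ Λ_p(a)` (the canonical representative of the class `ε ∈ Λ/2Λ ≅ (ℤ/2)ⁿ⁺¹`), threshold `d`;
`dist(x_ε, 2Λ) = λ₁(x_ε + 2Λ)` is the minimum of a coset.  Half-lattice points are the torsion order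
of the NP-hard instances (ABSS: `2b₀ ∈ L(B)`, tree `ABSS.inst`), which is what the Hecke move preserves. -/
def gmInst (p : ℕ) (a : Fin n → Fin p) (ε : Fin (n + 1) → Bool) (d : ℕ) : GapCVPInstance :=
  (⟨⟨n + 1, (2 : ℤ) • gmBasis p a⟩,
    Matrix.vecMul (fun i => if ε i then (1 : ℤ) else 0) (gmBasis p a)⟩, (d : ℚ))

/-- Number of integer points of `ℤⁿ⁺¹` in the closed ball of radius `R` (finite: inside the cube). -/
def intBallCount (n : ℕ) (R : ℝ) : ℕ :=
  (Finset.univ.filter fun e : Fin (n + 1) → Fin (2 * Nat.ceil R + 1) =>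
    ∑ i, (((e i : ℕ) : ℝ) - (Nat.ceil R : ℝ)) ^ 2 ≤ R ^ 2).card

end GM

/-- The random family of card B at dimension `n+1`. -/
abbrev GMFamily (n p : ℕ) : Type := (Fin n → Fin p) × (Fin (n + 1) → Bool)

/-- Admissible parameter sequences: `p n` prime and pinned to the scale where a uniform half-point
class is `c·d`-far from `2Λ_p(a)` for at least `3/4` of the pairs `(a, ε)` BY COUNTING
(`#close ≤ pⁿ + pⁿ⁻¹·N(cd)`: a nonzero integer point `y` of norm `≤ cd < p` lies in `Λ_p(a)` for exactly
`pⁿ⁻¹` of the `a`), and not larger (so that the Gaussian-heuristic coset minimum of `2Λ_p(a)` stays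
`(1+o(1))·Θ(c·d)`: constant gap), with `d n ≥ n` so that `N(cd) ≍ vol B(cd)`. -/
def GMAdmissible (c : ℝ) (p d : ℕ → ℕ) : Prop :=
  ∀ n, (p n).Prime ∧ n ≤ d n ∧ c * d n < p n ∧
    4 * intBallCount n (c * d n) ≤ 2 ^ (n + 1) * p n ∧ 2 ^ (n + 1) * p n ≤ 16 * intBallCount n (c * d n)

/-- APEX of card B: for every admissible scale, no NP language avoids the codes of the `d`-close
members `(2Λ_p(a), x_ε)` (YES instances) while containing at least half of the family, for all large
`n` — "deep half-lattice points of Haar-random lattices have no NP certificate of depth at constant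
factor".  By `HeckeRSR` below this is (via Hecke equidistribution on the level-2 congruence quotient)
EQUIVALENT to the crux up to the factor, not a strengthening of it. -/
def GMIrrefutable (c : ℝ) : Prop :=
  ∀ p d : ℕ → ℕ, GMAdmissible c p d →
    ¬ ∃ L ∈ Nondeterministic.NP,
      (∀ (n : ℕ) (q : GMFamily n (p n)), gmInst (p n) q.1 q.2 (d n) ∈ GapCVP.yes (fun _ => c) →
          GapCVPInstance.encode (gmInst (p n) q.1 q.2 (d n)) ∉ L) ∧
      ∃ n₀ : ℕ, ∀ n ≥ n₀, Fintype.card (GMFamily n (p n)) ≤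
        2 * (Finset.univ.filter fun q : GMFamily n (p n) => GapCVPInstance.encode (gmInst (p n) q.1 q.2 (d n)) ∈ L).card

/-- Density by pure counting (provable now): for admissible parameters at least half of the family
is `c`-far: `#{(a,ε) : dist(x_ε, 2Λ_p(a)) ≤ c·d} ≤ Σ_{y ∈ ℤⁿ⁺¹, ‖y‖ ≤ cd} #{a : y ∈ Λ_p(a)} ≤ pⁿ + pⁿ⁻¹·N(cd)
≤ |family|/2 = pⁿ·2ⁿ` (each close pair has a witness `y ∈ (x_ε + 2Λ_p(a)) ∩ B(cd)`, and `y` determines `ε`). -/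
theorem gm_mostly_far (c : ℝ) (hc : 1 ≤ c) (p d : ℕ → ℕ) (h : GMAdmissible c p d) (n : ℕ) :
    Fintype.card (GMFamily n (p n)) ≤
      2 * (Finset.univ.filter fun q : GMFamily n (p n) =>
        gmInst (p n) q.1 q.2 (d n) ∈ GapCVP.no (fun _ => c)).card := by
  sorry

/-- Admissible sequences exist (Bertrand's postulate in `[2N, 4N]`). -/
theorem exists_gmAdmissible (c : ℝ) (hc : 1 ≤ c) : ∃ p d : ℕ → ℕ, GMAdmissible c p d := by
  sorry

/-- FIRST LEMMA of card B (density direction, provable now): average-case irrefutability of the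
Goldstein–Mayer family at factor `c` gives `GapCVP_c ∉ PromiseCoNP`. -/
theorem targetAt_of_gmIrrefutable (c : ℝ) (hc : 1 ≤ c) (hirr : GMIrrefutable c) : TargetAt c := by
  obtain ⟨p, d, hadm⟩ := exists_gmAdmissible c hc
  intro hmem
  obtain ⟨L, hL, hyes, hno⟩ := hmem
  have hL' : Lᶜ ∈ Nondeterministic.NP := hL
  apply hirr p d hadm
  refine ⟨Lᶜ, hL', ?_, ?_⟩
  · intro n q hq hcode
    exact hcode (hyes ((Computability.Encoding.mem_toLanguage_iff _ _ _).2 hq))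
  · refine ⟨0, fun n _ => (gm_mostly_far c hc p d hadm n).trans
      (Nat.mul_le_mul_left 2 (Finset.card_le_card ?_))⟩
    intro q hq
    simp only [Finset.mem_filter, Finset.mem_univ, true_and] at hq ⊢
    exact hno ((Computability.Encoding.mem_toLanguage_iff _ _ _).2 hq)

theorem target_of_gmIrrefutable (c : ℝ) (hc : 1 ≤ c) (hirr : GMIrrefutable c) :
    Summit.PneNP.PneNP.Theses.LatticeMagic.Target :=
  ⟨c, hc, targetAt_of_gmIrrefutable c hc hirr⟩

/-! ### The superlattice move (one step of the Hecke operator `T_p`) -/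

section Superlattice

/-- `L + ℤ·(x_v / p)` where `x_v = Σ vᵢ bᵢ ∈ L`: for `v ≠ 0 (mod p)` an index-`p` SUPERlattice of
`L(B)`; `v ↦ L_v` enumerates the `(pⁿ-1)/(p-1)` neighbours of `L` under the Hecke operator `T_p`
(each `p - 1` times).  YES → YES is free: `dist(t, L_v) ≤ dist(t, L)`. -/
def superlattice (I : LatticeInstance) (p : ℕ) (v : Fin I.n → ZMod p) :
    Submodule ℤ (EuclideanSpace ℝ (Fin I.n)) :=
  I.lattice ⊔ Submodule.span ℤ {((p : ℝ)⁻¹) • I.ofCoeffs fun i => ((v i).val : ℤ)}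

theorem infDist_superlattice_le (I : LatticeInstance) (p : ℕ) (v : Fin I.n → ZMod p)
    (t : EuclideanSpace ℝ (Fin I.n)) :
    infDist t (superlattice I p v) ≤ infDist t I.lattice := by
  refine Metric.infDist_le_infDist_of_subset ?_ ⟨0, Submodule.zero_mem _⟩
  intro x hx
  exact (le_sup_left : I.lattice ≤ superlattice I p v) hx

/-- FAR-PRESERVATION COUNT (provable now; the NO → NO half of the self-reduction): if `t` is `r`-far
from `L`, the number of `v` whose superlattice comes within `r` of `t` is at most `(p-1)` times the
number of points of the finer lattice `p⁻¹L` in the ball `B(t, r)` (each bad `v` is `k⁻¹·w` for a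
bad `p`-division class `w` and some `k ∈ (ℤ/p)ˣ`).  With `#(p⁻¹L ∩ B(t,r)) ≲ pⁿ·vol B(r)/det L`
this is a `p·vol B(r)/det L` fraction of all `v` — negligible at the admissible scale. -/
theorem superlattice_far (I : LatticeInstance) (hI : I.IsNonsingular) (p : ℕ) (hp : p.Prime)
    (t : EuclideanSpace ℝ (Fin I.n)) (r : ℝ) (hr : r < infDist t I.lattice) :
    Set.ncard {v : Fin I.n → ZMod p | infDist t (superlattice I p v) ≤ r} ≤
      (p - 1) * Set.ncard {x : EuclideanSpace ℝ (Fin I.n) |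
        x ∈ ((p : ℝ)⁻¹ • (I.lattice : Set (EuclideanSpace ℝ (Fin I.n)))) ∧ dist x t ≤ r} := by
  sorry

end Superlattice

/-! ### The sparse (unique-decoding) half-point sub-promise, where the self-reduction lives -/

/-- YES instances of the SPARSE HALF-POINT sub-promise of `GapCVP_c`: close (`dist ≤ d`), the target is a
half-lattice point (`2t ∈ L(B)`, as in `ABSS.inst`), and the lattice has no vector shorter than
`n^A · c · d` (polynomial uniqueness gap: the regime in which a random prime-index superlattice at the
matched covolume inherits no atypically short vector). -/
def SparseYes (A c : ℝ) : Set GapCVPInstance :=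
  {q | q ∈ GapCVP.yes (fun _ => c) ∧ (2 : ℝ) • q.1.targetE ∈ q.1.I.lattice ∧
    (q.1.I.n : ℝ) ^ A * c * (q.2 : ℝ) ≤ minNorm q.1.I.lattice}

/-- NO instances of the sparse half-point sub-promise (`dist > c·d`, same side conditions). -/
def SparseNo (A c : ℝ) : Set GapCVPInstance :=
  {q | q ∈ GapCVP.no (fun _ => c) ∧ (2 : ℝ) • q.1.targetE ∈ q.1.I.lattice ∧
    (q.1.I.n : ℝ) ^ A * c * (q.2 : ℝ) ≤ minNorm q.1.I.lattice}

/-- The crux restricted to the sparse half-point sub-promise. -/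
def TargetSparseAt (A c : ℝ) : Prop :=
  PromiseProblem.ofEncoding gapCVPInstanceEncoding (SparseYes A c) (SparseNo A c) ∉ PromiseCoNP

/-- A sub-promise is easier: certificates for `GapCVP_c` restrict (provable now, monotonicity). -/
theorem targetAt_of_targetSparseAt (A c : ℝ) (h : TargetSparseAt A c) : TargetAt c := by
  intro hmem
  apply h
  obtain ⟨L, hL, hyes, hno⟩ := hmem
  refine ⟨L, hL, ?_, ?_⟩
  · rintro x ⟨q, hq, rfl⟩
    exact hyes ⟨q, hq.1, rfl⟩
  · rintro x ⟨q, hq, rfl⟩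
    exact hno ⟨q, hq.1, rfl⟩

/-- OPEN STUB K2 (hardness frontier of BDD/uSVP): for some `A < 1/2` and constant `c`, the sparse
half-point sub-promise is NP-hard (randomised reductions would suffice for a collapse).  Known: `A = 0`
with `c < √2` (Liu–Lyubashevsky–Micciancio 2006, Bennett–Peikert 2020, search BDD); impossible for
`A ≥ 1/2` unless the hierarchy collapses (Lyubashevsky–Micciancio 2009 + Aharonov–Regev 2005). -/
def SparseHalfPointHard (A c : ℝ) : Prop :=
  (PromiseProblem.ofEncoding gapCVPInstanceEncoding (SparseYes A c) (SparseNo A c)).IsNPHard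

/-- OPEN STUB K1 + assembly (random self-reduction of REFUTATION onto the invariant measure): from
coNP-hardness of the sparse half-point sub-promise at factor `2c` to average-case irrefutability of the
Goldstein–Mayer half-point family at factor `c`.  Intended proof: given an NP refuter `R` of density
`1/2` for the family, certify a worst-case sparse far instance `(B, t, d)` by a random Hecke neighbour
`L_v = L + ℤx_v/p` with `p` prime at the MATCHED covolume (`GH(L_v) ≍ c·d`; YES → YES by
`infDist_superlattice_le`, soundness is worst case in `v`), `n^{-O(1)}` multiplicative noise and a
wide-Gaussian basis re-randomisation, the `R`-witness of the output being the certificate;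
completeness = the output law is close to the family law: MATCHED-SCALE EQUIDISTRIBUTION of the pairs
(`T_p`-neighbour, half-point class) on `Γ₁(2)\SL_n(ℝ)` for sparse, balanced base lattices and deep
torsion points — beyond the `p^{-1/2}` degenerate-Eisenstein rate of Clozel–Oh–Ullmo, which is
carried exactly by the short-vector statistics that sparsity removes (precedents of the move: de
Boer–Ducas–Pellet-Mary–Wesolowski 2020, Ducas–van Woerden 2022; Goldstein–Mayer 2003 for
`Λ_p(a) → Haar`).  No solution is mapped back, so the factor loss is `1 + o(1)` (written `2`). -/
def HeckeRSR (A : ℝ) : Prop :=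
  ∀ c : ℝ, 1 ≤ c → TargetSparseAt A (2 * c) → GMIrrefutable c

/-- With both stubs the average-case apex sits between the crux at factor `c` and NP ≠ coNP read on the
sparse sub-promise at factor `2c`: `GMIrrefutable c → TargetAt c` (proved direction) and
`TargetSparseAt A (2c) → GMIrrefutable c` (K1); K2 makes `TargetSparseAt A (2c)` itself a consequence
of `NP ≠ coNP`, closing the circle `X ⟺ C⁺₂` up to the factor. -/
theorem gm_sandwich (A c : ℝ) (hc : 1 ≤ c) (h1 : HeckeRSR A) :
    (GMIrrefutable c → TargetAt c) ∧ (TargetSparseAt A (2 * c) → GMIrrefutable c) :=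
  ⟨targetAt_of_gmIrrefutable c hc, h1 c hc⟩

end Summit.PneNP.PneNP.Cruxes.Target.Ideator1
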